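import Literature.Computability.FineGrained.MinPlusToNegativeTriangleSweepSetup
import HarnessLib

/-!
# Distance product `≤₃` Negative Triangle: the queries and the cell sweep

The query layer of the cell-sweep product step `NegTriSweep.psNT`
(`Literature.Computability.FineGrained.MinPlusToNegativeTriangleSweepProgram`; Vassilevska
Williams–Williams, J. ACM 65 (2018), Thm. 4.2, proof pp. 27:17–18, with Lemma 4.2, p. 27:16):

* the query buffer is the encoding of the tripartite query graph `QData.qmat` of
  `Literature.Computability.FineGrained.MinPlusToNegativeTriangleGadget` (`readSeg_query`,
  `query_cells`), the codes written by `blockCopy`/`buildT` are its arcs (`bcVal_eq_entryOr`,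
  `tbVal_eq_tarc`), the query graph is a `NegativeTriangle (6c + 11)`-instance (`big_le_pow`,
  `negTri_inst`) and the oracle's answer bit is `[q.Witness]` (`oracle_answer`);
* pair witnesses under marking (`pairWit_congr`, `pairWit_anti`, …), the count of marked pairs
  (`marks_mono`, `marks_lt`, `marks_le`), and the address bookkeeping of the back-arc block;
* **one cell probe** (`cells_iter`) and **the cell sweep of a positive block triple**
  (`cells_spec`): afterwards the triple has no pair witness, every mark is sound, and the number
  of marked pairs went up (this replaces the find-and-delete loop of VW–W Lemmas 4.1–4.2 inside a
  triple).

## References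

* V. Vassilevska Williams, R. R. Williams, *Subcubic equivalences between path, matrix, and
  triangle problems*, J. ACM 65 (2018), Art. 27, Thm. 4.2 (p. 27:14; proof pp. 27:17–18),
  Lemma 4.1 (pp. 27:14–15), Lemma 4.2 (p. 27:16; proof pp. 27:16–17).
-/

namespace Literature.Computability.FineGrained.NegTriSweep

open Cryptography Cryptography.WordRAM Cryptography.WordRAM.SProg APSPPower Matrix NegTriStep

/-! ## The query buffer is the encoding of the query graph -/

/-- The code of a finite weight. [folklore] -/
theorem encodeWithTopInt_coe (z : ℤ) : encodeWithTopInt (z : WithTop ℤ) = encodeInt z + 1 := rfl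

/-- The non-edge code `BIGC = 32M + 9` is the code of the non-edge weight `big M`. [folklore] -/
theorem bigc_eq (M : ℕ) : 32 * M + 9 = encodeInt (big M : ℤ) + 1 := by
  rw [show ((big M : ℕ) : ℤ) = ((16 * M + 4 : ℕ) : ℤ) by rfl, encodeInt_natCast]; omega

/-- **The query buffer is the encoding of the query graph**: if the header cell holds `3L` and
every cell `(u, v)` of the query matrix holds the code of `q.qmatN u v`, then the `9L² + 1` words
from `QB` are `encodeMatrixWithTop` of `q.qmat`. [folklore] -/
theorem readSeg_query {n F : ℕ} {H : ℕ → ℕ} (q : QData n) (hL : q.L = cL n)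
    (hhdr : H (F + 2 * (n * n)) = 3 * cL n)
    (hall : ∀ u v, u < 3 * cL n → v < 3 * cL n → H (qcell n F u v) = encodeInt (q.qmatN u v) + 1) :
    readSeg H (F + 2 * (n * n)) (9 * (cL n * cL n) + 1) =
      encodeMatrixWithTop (q.qmat.map ((↑) : ℤ → WithTop ℤ)) := by
  have hlen : (encodeMatrixWithTop (q.qmat.map ((↑) : ℤ → WithTop ℤ))).length = 9 * (cL n * cL n) + 1 := by
    rw [encodeMatrixWithTop_length, hL]; ring
  refine readSeg_eq_of_forall hlen fun j hj => ?_
  rcases j with _ | m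
  · rw [Nat.add_zero, hhdr, NegTriToAPSP.getElem_encodeMatrixWithTop_zero, hL]
  · have hm : m < 3 * q.L * (3 * q.L) := by rw [hL]; nlinarith
    have h3L : 0 < 3 * q.L := by rw [hL]; have := one_le_cL n; omega
    rw [NegTriToAPSP.getElem_encodeMatrixWithTop_succ _ m hm]
    simp only [Matrix.map_apply, Fin.divNat, Fin.modNat, encodeWithTopInt_coe, QData.qmat]
    have hu : m / (3 * q.L) < 3 * cL n := by rw [← hL]; exact Nat.div_lt_of_lt_mul (by rwa [Nat.mul_comm] at hm)
    have hv : m % (3 * q.L) < 3 * cL n := by rw [← hL]; exact Nat.mod_lt _ h3L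
    rw [← hall _ _ hu hv]
    unfold qcell
    congr 1
    rw [← hL]
    have := Nat.div_add_mod' m (3 * q.L)
    omega

/-- **The cells of the query matrix from its four parts**: background, `X`-block, `Y`-block and the
back arcs. [folklore] -/
theorem query_cells {n c F : ℕ} {H : ℕ → ℕ} (q : QData n) (hL : q.L = cL n) (hM : q.M = cM c n)
    (hbg : ∀ u v, u < 3 * cL n → v < 3 * cL n → ¬ (u / cL n = 0 ∧ v / cL n = 1) →
      ¬ (u / cL n = 1 ∧ v / cL n = 2) → ¬ (u / cL n = 2 ∧ v / cL n = 0) →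
      H (qcell n F u v) = 32 * cM c n + 9)
    (hX : ∀ il kl, il < cL n → kl < cL n → H (qcell n F il (cL n + kl)) = encodeInt (q.xarc il kl) + 1)
    (hY : ∀ kl jl, kl < cL n → jl < cL n →
      H (qcell n F (cL n + kl) (2 * cL n + jl)) = encodeInt (q.yarc kl jl) + 1)
    (hT : ∀ iu iv, iu < cL n → iv < cL n → H (qcell n F (2 * cL n + iu) iv) = encodeInt (q.tarc iu iv) + 1) :
    ∀ u v, u < 3 * cL n → v < 3 * cL n → H (qcell n F u v) = encodeInt (q.qmatN u v) + 1 := by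
  have hL1 := one_le_cL n
  intro u v hu hv
  unfold QData.qmatN
  rw [hL]
  by_cases h01 : u / cL n = 0 ∧ v / cL n = 1
  · rw [if_pos h01]
    have hu' : u < cL n := by have := Nat.div_eq_zero_iff.1 h01.1; omega
    have hv' : cL n ≤ v ∧ v < 2 * cL n := by
      constructor
      · by_contra h; have : v / cL n = 0 := Nat.div_eq_of_lt (by omega); omega
      · by_contra h; have : 2 ≤ v / cL n := (Nat.le_div_iff_mul_le (by omega)).2 (by omega); omega
    obtain ⟨kl, rfl⟩ : ∃ kl, v = cL n + kl := ⟨v - cL n, by omega⟩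
    rw [hX u kl hu' (by omega), Nat.mod_eq_of_lt hu', Nat.add_comm (cL n) kl, Nat.add_mod_right,
      Nat.mod_eq_of_lt (show kl < cL n by omega)]
  rw [if_neg h01]
  by_cases h12 : u / cL n = 1 ∧ v / cL n = 2
  · rw [if_pos h12]
    have hu' : cL n ≤ u ∧ u < 2 * cL n := by
      constructor
      · by_contra h; have : u / cL n = 0 := Nat.div_eq_of_lt (by omega); omega
      · by_contra h; have : 2 ≤ u / cL n := (Nat.le_div_iff_mul_le (by omega)).2 (by omega); omega
    have hv' : 2 * cL n ≤ v := by
      by_contra h; have : v / cL n < 2 := Nat.div_lt_of_lt_mul (by omega); omega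
    obtain ⟨kl, rfl⟩ : ∃ kl, u = cL n + kl := ⟨u - cL n, by omega⟩
    obtain ⟨jl, rfl⟩ : ∃ jl, v = 2 * cL n + jl := ⟨v - 2 * cL n, by omega⟩
    rw [hY kl jl (by omega) (by omega), Nat.add_comm (cL n) kl, Nat.add_mod_right,
      Nat.mod_eq_of_lt (show kl < cL n by omega), Nat.add_comm (2 * cL n) jl, Nat.add_mul_mod_self_right,
      Nat.mod_eq_of_lt (show jl < cL n by omega)]
  rw [if_neg h12]
  by_cases h20 : u / cL n = 2 ∧ v / cL n = 0
  · rw [if_pos h20]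
    have hu' : 2 * cL n ≤ u := by
      by_contra h; have : u / cL n < 2 := Nat.div_lt_of_lt_mul (by omega); omega
    have hv' : v < cL n := by have := Nat.div_eq_zero_iff.1 h20.2; omega
    obtain ⟨iu, rfl⟩ : ∃ iu, u = 2 * cL n + iu := ⟨u - 2 * cL n, by omega⟩
    rw [hT iu v (by omega) hv', Nat.add_comm (2 * cL n) iu, Nat.add_mul_mod_self_right,
      Nat.mod_eq_of_lt (show iu < cL n by omega), Nat.mod_eq_of_lt hv']
  rw [if_neg h20, hbg u v hu hv h01 h12 h20, hM, bigc_eq]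

/-! ## The codes written by `blockCopy` and `buildT` are the arcs of the query graph -/

/-- **`bcVal` is the code of `entryOr`**: reading an operand held as a code block (`MatAt`), the
value written by `blockCopy` for `(il, kl)` with offsets `(ro, co)` is the code of
`QData.entryOr X M (ro + il) (co + kl)`. [folklore] -/
theorem bcVal_eq_entryOr {n M p ro co il kl : ℕ} {H : ℕ → ℕ} {X : Matrix (Fin n) (Fin n) (WithTop ℤ)}
    (hX : MatAt H p X) :
    bcVal H n (32 * M + 9) (p + 1) ro co il kl = encodeInt (QData.entryOr X M (ro + il) (co + kl)) + 1 := by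
  unfold bcVal QData.entryOr
  by_cases hr : ro + il < n ∧ co + kl < n
  · rw [dif_pos hr]
    have hcode := hX ⟨ro + il, hr.1⟩ ⟨co + kl, hr.2⟩
    simp only at hcode
    rw [hcode]
    cases hx : X ⟨ro + il, hr.1⟩ ⟨co + kl, hr.2⟩ with
    | top => simp only [encodeWithTopInt, hr, true_and, ne_eq, not_true_eq_false, if_false]; exact bigc_eq M
    | coe z => simp [encodeWithTopInt_coe, hr]
  · rw [dif_neg hr, if_neg (fun h => hr ⟨h.1, h.2.1⟩)]; exact bigc_eq M

/-- **`tbVal` is the code of the back arc** of the query of the block triple with the window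
`(nfr, rsel) × (nfc, csel)`: `QData.tarc` of `(qd X Y H c F pw bi bj bk).setWin …`. [folklore] -/
theorem tbVal_eq_tarc {n c F pw bi bj bk nfr rsel nfc csel iu iv : ℕ} {H : ℕ → ℕ}
    {X Y : Matrix (Fin n) (Fin n) (WithTop ℤ)} (hnfr : nfr = 0 ∧ rsel = 0 ∨ nfr = 1)
    (hnfc : nfc = 0 ∧ csel = 0 ∨ nfc = 1) (hiu : iu < cL n) (hiv : iv < cL n) :
    tbVal H n F (F + n * n) (2 * cM c n) (32 * cM c n + 9) pw (cL n) bi bj nfr rsel nfc csel iu iv =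
      encodeInt (((qd X Y H c F pw bi bj bk).setWin (winLo nfr rsel) (winHi nfr rsel (cL n))
        (winLo nfc csel) (winHi nfc csel (cL n))).tarc iu iv) + 1 := by
  have hwr := inWin_iff (L := cL n) hnfr hiv
  have hwc := inWin_iff (L := cL n) hnfc hiu
  unfold InWin at hwr hwc
  unfold tbVal QData.tarc QData.Active QData.setWin qd mkQ
  simp only
  by_cases ha : bi * cL n + iv < n ∧ bj * cL n + iu < n ∧ iv * nfr = rsel ∧ iu * nfc = csel ∧
      H (F + n * n + ((bi * cL n + iv) * n + (bj * cL n + iu))) ≠ pw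
  · rw [if_pos ha, if_pos ⟨ha.1, ha.2.1, (hwr.1 ha.2.2.1).1, (hwr.1 ha.2.2.1).2, (hwc.1 ha.2.2.2.1).1,
      (hwc.1 ha.2.2.2.1).2, ha.2.2.2.2⟩, zzCode_eq, ← encodeWithTopInt_coe]
    push_cast
    rfl
  · rw [if_neg ha, if_neg]
    · exact bigc_eq _
    · rintro ⟨h1, h2, h3, h4, h5, h6, h7⟩
      exact ha ⟨h1, h2, hwr.2 ⟨h3, h4⟩, hwc.2 ⟨h5, h6⟩, h7⟩

/-! ## The oracle's answer -/

/-- **The query graph has small weights**: `big M ≤ (3L)^{6c + 11}` (`M = 2^{(c+1)s}`,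
`L = 2^{⌈s/6⌉}`, `s ≥ 1`). [folklore] -/
theorem big_le_pow {c n : ℕ} (hn : 1 ≤ n) : big (cM c n) ≤ (3 * cL n) ^ (6 * c + 11) := by
  have hs : 1 ≤ Nat.size n := Nat.size_pos.2 (by omega)
  set s := Nat.size n with hsdef
  set t := (s + 5) / 6 with htdef
  have ht1 : 1 ≤ t := by omega
  have h6t : s ≤ 6 * t := by omega
  have hM : cM c n = 2 ^ ((c + 1) * s) := rfl
  have hL : cL n = 2 ^ t := rfl
  calc big (cM c n) = 16 * 2 ^ ((c + 1) * s) + 4 := by rw [big, hM]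
    _ ≤ 32 * 2 ^ ((c + 1) * s) := by have := Nat.one_le_two_pow (n := (c + 1) * s); omega
    _ = 2 ^ ((c + 1) * s + 5) := by rw [pow_add]; norm_num; ring
    _ ≤ 2 ^ (t * (6 * c + 11)) := Nat.pow_le_pow_right (by norm_num) (by nlinarith)
    _ = (2 ^ t) ^ (6 * c + 11) := by rw [pow_mul]
    _ ≤ (3 * cL n) ^ (6 * c + 11) := by rw [hL]; exact Nat.pow_le_pow_left (by omega) _

/-- The Negative-Triangle instance of a query. [folklore] -/
theorem negTri_inst {n c : ℕ} (hn : 1 ≤ n) (q : QData n) (hL : q.L = cL n) (hM : q.M = cM c n)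
    (hX : HasBoundedWeights q.X q.M) (hY : HasBoundedWeights q.Y q.M)
    (hlo : ∀ t, t < n * n → q.lo t + q.pw ≤ 8 * q.M + 2) :
    (⟨3 * q.L, q.qmat⟩ : Σ m, Matrix (Fin m) (Fin m) ℤ) ∈
      {W : Σ m, Matrix (Fin m) (Fin m) ℤ | HasBoundedWeights (W.2.map (↑)) (W.1 ^ (6 * c + 11))} := by
  show HasBoundedWeights (q.qmat.map (↑)) ((3 * q.L) ^ (6 * c + 11))
  intro u v
  rcases q.hasBoundedWeights_qmat hX hY hlo u v with h | ⟨z, hz, hzb⟩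
  · exact Or.inl h
  · refine Or.inr ⟨z, hz, hzb.trans ?_⟩
    rw [hL, hM]
    exact_mod_cast big_le_pow (c := c) hn

open Classical in
/-- **The oracle's answer on a query**: an oracle answering `NegativeTriangle (6c + 11)` returns
`[1]` if the query graph has a witness and `[0]` otherwise. [folklore] -/
theorem oracle_answer {n c : ℕ} {O : List ℕ → List ℕ} (hO : (NegativeTriangle (6 * c + 11)).OracleAnswers O)
    (hn : 1 ≤ n) (q : QData n) (hL : q.L = cL n) (hM : q.M = cM c n)
    (hX : HasBoundedWeights q.X q.M) (hY : HasBoundedWeights q.Y q.M)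
    (hlo : ∀ t, t < n * n → q.lo t + q.pw ≤ 8 * q.M + 2) :
    ∃ y : (NegativeTriangle (6 * c + 11)).Inst,
      (NegativeTriangle (6 * c + 11)).encode y = encodeMatrixWithTop (q.qmat.map ((↑) : ℤ → WithTop ℤ)) ∧
      (NegativeTriangle (6 * c + 11)).size y = 3 * cL n ∧
      O (encodeMatrixWithTop (q.qmat.map ((↑) : ℤ → WithTop ℤ))) = [if q.Witness then 1 else 0] := by
  refine ⟨⟨⟨3 * q.L, q.qmat⟩, negTri_inst hn q hL hM hX hY hlo⟩, rfl, by show 3 * q.L = 3 * cL n; rw [hL], ?_⟩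
  have hans := hO ⟨⟨3 * q.L, q.qmat⟩, negTri_inst hn q hL hM hX hY hlo⟩
  have hL0 : 0 < q.L := by rw [hL]; exact one_le_cL n
  have hiff := q.hasNegativeTriangle_qmat_iff hX hY hlo hL0
  by_cases hw : q.Witness
  · have hneg : HasNegativeTriangle q.qmat := hiff.2 hw
    have h1 : O (encodeMatrixWithTop (q.qmat.map ((↑) : ℤ → WithTop ℤ))) = [1] := by
      simpa [NegativeTriangle, FGProblem.restrict, FGProblem.ofPred, hneg] using hans
    rw [h1, if_pos hw]
  · have hneg : ¬ HasNegativeTriangle q.qmat := fun h => hw (hiff.1 h)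
    have h0 : O (encodeMatrixWithTop (q.qmat.map ((↑) : ℤ → WithTop ℤ))) = [0] := by
      simpa [NegativeTriangle, FGProblem.restrict, FGProblem.ofPred, hneg] using hans
    rw [h0, if_neg hw]

end Literature.Computability.FineGrained.NegTriSweep

namespace Literature.Computability.FineGrained.NegTriSweep

open Cryptography Cryptography.WordRAM Cryptography.WordRAM.SProg APSPPower Matrix NegTriStep

/-! ## Pair witnesses under changes of `lo`/`fd` -/

section pairwit

variable {n : ℕ} {X Y : Matrix (Fin n) (Fin n) (WithTop ℤ)} {M pw L bi bj bk : ℕ} {lo fd lo' fd' : ℕ → ℕ}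

/-- Pair witnesses only read `lo` and `fd` below `n²`. [folklore] -/
theorem pairWit_congr (hlo : ∀ t, t < n * n → lo' t = lo t) (hfd : ∀ t, t < n * n → fd' t = fd t)
    (iu iv : ℕ) :
    (mkQ X Y lo' fd' M pw L bi bj bk).PairWit iu iv ↔ (mkQ X Y lo fd M pw L bi bj bk).PairWit iu iv := by
  unfold QData.PairWit mkQ
  simp only
  constructor
  · rintro ⟨hi, hj, hf, kk, hkk, hk, x, y, hx, hy, hlt⟩
    have hidx : (bi * L + iv) * n + (bj * L + iu) < n * n := NegTriToAPSP.mul_add_lt_mul hi hj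
    refine ⟨hi, hj, ?_, kk, hkk, hk, x, y, hx, hy, ?_⟩
    · rw [← hfd _ hidx]; exact hf
    · rw [← hlo _ hidx]; exact hlt
  · rintro ⟨hi, hj, hf, kk, hkk, hk, x, y, hx, hy, hlt⟩
    have hidx : (bi * L + iv) * n + (bj * L + iu) < n * n := NegTriToAPSP.mul_add_lt_mul hi hj
    refine ⟨hi, hj, ?_, kk, hkk, hk, x, y, hx, hy, ?_⟩
    · rw [hfd _ hidx]; exact hf
    · rw [hlo _ hidx]; exact hlt

/-- Marking pairs found can only destroy pair witnesses. [folklore] -/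
theorem pairWit_anti (hlo : ∀ t, t < n * n → lo' t = lo t)
    (hfd : ∀ t, t < n * n → fd' t = fd t ∨ fd' t = pw) {iu iv : ℕ}
    (h : (mkQ X Y lo' fd' M pw L bi bj bk).PairWit iu iv) : (mkQ X Y lo fd M pw L bi bj bk).PairWit iu iv := by
  unfold QData.PairWit mkQ at h ⊢
  simp only at h ⊢
  obtain ⟨hi, hj, hf, kk, hkk, hk, x, y, hx, hy, hlt⟩ := h
  have hidx : (bi * L + iv) * n + (bj * L + iu) < n * n := NegTriToAPSP.mul_add_lt_mul hi hj
  refine ⟨hi, hj, ?_, kk, hkk, hk, x, y, hx, hy, ?_⟩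
  · rcases hfd _ hidx with h | h
    · rw [← h]; exact hf
    · exact absurd h hf
  · rw [← hlo _ hidx]; exact hlt

/-- Marking *another* pair keeps a pair witness. [folklore] -/
theorem pairWit_update_of_ne {idx iu iv : ℕ} (h : (mkQ X Y lo fd M pw L bi bj bk).PairWit iu iv)
    (hne : (bi * L + iv) * n + (bj * L + iu) ≠ idx) :
    (mkQ X Y lo (Function.update fd idx pw) M pw L bi bj bk).PairWit iu iv := by
  unfold QData.PairWit mkQ at h ⊢
  simp only at h ⊢
  obtain ⟨hi, hj, hf, kk, hkk, hk, x, y, hx, hy, hlt⟩ := h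
  refine ⟨hi, hj, ?_, kk, hkk, hk, x, y, hx, hy, hlt⟩
  rw [Function.update_of_ne hne]; exact hf

/-- A pair witness is in range and not yet found. [folklore] -/
theorem QData.PairWit.mkQ_range {iu iv : ℕ} (h : (mkQ X Y lo fd M pw L bi bj bk).PairWit iu iv) :
    bi * L + iv < n ∧ bj * L + iu < n ∧ fd ((bi * L + iv) * n + (bj * L + iu)) ≠ pw := by
  unfold QData.PairWit mkQ at h
  simp only at h
  obtain ⟨hi, hj, hf, -⟩ := h
  exact ⟨hi, hj, hf⟩

/-- Row-major indices of in-range pairs are injective. [folklore] -/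
theorem idx_inj {i j i' j' : ℕ} (hj : j < n) (hj' : j' < n) (h : i * n + j = i' * n + j') :
    i = i' ∧ j = j' := by
  have h1 : (i * n + j) / n = i := NegTriToAPSP.div_of_mul_add hj
  have h2 : (i' * n + j') / n = i' := NegTriToAPSP.div_of_mul_add hj'
  have hi : i = i' := by rw [← h1, ← h2, h]
  subst hi
  exact ⟨rfl, by omega⟩

end pairwit

/-! ## The count of marked pairs -/

section marks

variable {n F pw : ℕ} {H H' : ℕ → ℕ}

/-- Marks only accumulate. [folklore] -/
theorem marks_mono (h : ∀ t, t < n * n → H' (F + n * n + t) = H (F + n * n + t) ∨ H' (F + n * n + t) = pw) :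
    marks H n F pw ≤ marks H' n F pw := by
  unfold marks
  refine Finset.card_le_card fun t ht => ?_
  simp only [Finset.mem_filter, Finset.mem_range] at ht ⊢
  refine ⟨ht.1, ?_⟩
  rcases h t ht.1 with h | h
  · rw [h]; exact ht.2
  · exact h

/-- A new mark increases the count. [folklore] -/
theorem marks_lt (h : ∀ t, t < n * n → H' (F + n * n + t) = H (F + n * n + t) ∨ H' (F + n * n + t) = pw)
    {t₀ : ℕ} (ht₀ : t₀ < n * n) (h0 : H (F + n * n + t₀) ≠ pw) (h1 : H' (F + n * n + t₀) = pw) :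
    marks H n F pw < marks H' n F pw := by
  unfold marks
  refine Finset.card_lt_card ((Finset.ssubset_iff_of_subset fun t ht => ?_).2 ⟨t₀, ?_, ?_⟩)
  · simp only [Finset.mem_filter, Finset.mem_range] at ht ⊢
    refine ⟨ht.1, ?_⟩
    rcases h t ht.1 with h | h
    · rw [h]; exact ht.2
    · exact h
  · simp only [Finset.mem_filter, Finset.mem_range]; exact ⟨ht₀, h1⟩
  · simp only [Finset.mem_filter, Finset.mem_range, not_and]; exact fun _ => h0

/-- At most `n²` pairs are marked. [folklore] -/
theorem marks_le (H : ℕ → ℕ) (n F pw : ℕ) : marks H n F pw ≤ n * n := by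
  unfold marks
  exact le_trans (Finset.card_filter_le _ _) (by simp)

end marks

/-! ## Addresses -/

/-- The cells written by `buildT` are the back-arc cells of the query matrix. [folklore] -/
theorem tcell_eq (n F r : ℕ) :
    F + 2 * (n * n) + 1 + 6 * (cL n * cL n) + r / cL n * (3 * cL n) + r % cL n =
      qcell n F (2 * cL n + r / cL n) (r % cL n) := by
  unfold qcell; ring

/-- A query cell outside the back-arc block is not written by `buildT`. [folklore] -/
theorem qcell_ne_tcell {n F u v r : ℕ} (hv : v < 3 * cL n) (hr : r < cL n * cL n)
    (h : ¬ (u / cL n = 2 ∧ v / cL n = 0)) :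
    qcell n F u v ≠ F + 2 * (n * n) + 1 + 6 * (cL n * cL n) + r / cL n * (3 * cL n) + r % cL n := by
  rw [tcell_eq]
  unfold qcell
  intro heq
  have hL := one_le_cL n
  have h1 : r % cL n < cL n := Nat.mod_lt _ (by omega)
  have h2 : r / cL n < cL n := Nat.div_lt_of_lt_mul hr
  have heq' : u * (3 * cL n) + v = (2 * cL n + r / cL n) * (3 * cL n) + r % cL n := by omega
  obtain ⟨hu, hv'⟩ := idx_inj (n := 3 * cL n) hv (by omega) heq'
  apply h
  subst hu hv'
  constructor
  · rw [Nat.add_comm, Nat.add_mul_div_right _ _ (by omega), Nat.div_eq_of_lt h2]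
  · exact Nat.div_eq_of_lt h1

/-- The back-arc cells lie inside the query matrix, above `QB` and below `AB`. [folklore] -/
theorem tcell_bounds {n F r : ℕ} (hr : r < cL n * cL n) :
    F + 2 * (n * n) + 1 ≤ F + 2 * (n * n) + 1 + 6 * (cL n * cL n) + r / cL n * (3 * cL n) + r % cL n ∧
      F + 2 * (n * n) + 1 + 6 * (cL n * cL n) + r / cL n * (3 * cL n) + r % cL n <
        F + 2 * (n * n) + (9 * (cL n * cL n) + 1) := by
  have hL := one_le_cL n
  have := div_mul_add_mod_lt (L3 := 3 * cL n) hL hr (by omega)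
  constructor
  · omega
  · nlinarith

/-- Query cells lie above `QB` and below `AB`. [folklore] -/
theorem qcell_bounds {n F u v : ℕ} (hu : u < 3 * cL n) (hv : v < 3 * cL n) :
    F + 2 * (n * n) + 1 ≤ qcell n F u v ∧ qcell n F u v < F + 2 * (n * n) + (9 * (cL n * cL n) + 1) := by
  unfold qcell
  have := NegTriToAPSP.mul_add_lt_mul' hu hv
  constructor
  · omega
  · nlinarith

end Literature.Computability.FineGrained.NegTriSweep

namespace Literature.Computability.FineGrained.NegTriSweep

open Cryptography Cryptography.WordRAM Cryptography.WordRAM.SProg APSPPower Matrix NegTriStep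

set_option linter.unusedSimpArgs false

/-! ## One cell probe -/

/-- Reading the answer bit of a one-word oracle answer written at `A`. [folklore] -/
theorem segWrite_single (H : ℕ → ℕ) (A b : ℕ) :
    segWrite H A [b] A = 1 ∧ segWrite H A [b] (A + 1) = b ∧
      ∀ a, a ≠ A → a ≠ A + 1 → segWrite H A [b] a = H a := by
  unfold segWrite
  refine ⟨by simp, ?_, fun a h1 h2 => ?_⟩
  · rw [if_neg (by omega), if_pos ⟨by omega, by simp⟩]; simp
  · rw [if_neg h1, if_neg (by simp; omega)]

open Classical in
/-- **One cell probe** (an iteration of the loop of `cells`): the registers of the cell, the back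
arcs for the single-cell window, the query, and — if the oracle reports a witness, i.e. iff the
cell's pair has a pair witness (`QData.witness_cell_iff`) — the marking of the pair. [folklore] -/
theorem cells_iter {w c n F pX pw bi bj bk cl : ℕ} {O : List ℕ → List ℕ}
    {X Y : Matrix (Fin n) (Fin n) (WithTop ℤ)} {H₀ S H : ℕ → ℕ} {qs : List (List ℕ)}
    (hR : Regs c n F pX S) (h40 : S 40 = pw) (h42 : S 42 = bi) (h43 : S 43 = bj)
    (h45 : S 45 = cl + 1) (hcl : cl < cL n * cL n)
    (hn : 1 ≤ n) (hF : 100 ≤ F) (hbi : bi < cNB n) (hbj : bj < cNB n)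
    (hst : Static c n F H₀ H)
    (hXb : ∀ il kl, il < cL n → kl < cL n → H (qcell n F il (cL n + kl)) =
      encodeInt (QData.entryOr X (cM c n) (bi * cL n + il) (bk * cL n + kl)) + 1)
    (hYb : ∀ kl jl, kl < cL n → jl < cL n → H (qcell n F (cL n + kl) (2 * cL n + jl)) =
      encodeInt (QData.entryOr Y (cM c n) (bk * cL n + kl) (bj * cL n + jl)) + 1)
    (hXM : HasBoundedWeights X (cM c n)) (hYM : HasBoundedWeights Y (cM c n))
    (hpw1 : 1 ≤ pw) (hpw4 : pw ≤ 4 * cM c n)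
    (hlo : ∀ t, t < n * n → H (F + t) + pw < 8 * cM c n)
    (hO : (NegativeTriangle (6 * c + 11)).OracleAnswers O)
    (hcapB : 2 * (32 * cM c n + 9) < 2 ^ w) (hcapN : (n + cL n) * n + (n + cL n) < 2 ^ w)
    (hcapW : F + wspNT n < 2 ^ w) :
    ∃ (S' H' : ℕ → ℕ) (y : (NegativeTriangle (6 * c + 11)).Inst),
      ExecLE w O (seqs [block cellOps, buildT, ask, ifz (.ind 36) skip (block markOps)]) ⟨merge S H, qs⟩
        ⟨merge S' H', qs ++ [(NegativeTriangle (6 * c + 11)).encode y]⟩ (cL n * cL n * 46 + 18) ∧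
      (∀ i, i < 45 ∨ 59 < i → S' i = S i) ∧ S' 45 = cl ∧
      Static c n F H₀ H' ∧
      (∀ u v, u < 3 * cL n → v < 3 * cL n → ¬ (u / cL n = 2 ∧ v / cL n = 0) →
        H' (qcell n F u v) = H (qcell n F u v)) ∧
      (∀ t, t < n * n → H' (F + t) = H (F + t)) ∧
      (∀ t, t < n * n → H' (F + n * n + t) = H (F + n * n + t) ∨
        (t = (bi * cL n + cl / cL n) * n + (bj * cL n + cl % cL n) ∧
          (qd X Y H c F pw bi bj bk).PairWit (cl % cL n) (cl / cL n) ∧ H' (F + n * n + t) = pw)) ∧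
      ((qd X Y H c F pw bi bj bk).PairWit (cl % cL n) (cl / cL n) →
        H' (F + n * n + ((bi * cL n + cl / cL n) * n + (bj * cL n + cl % cL n))) = pw) ∧
      (NegativeTriangle (6 * c + 11)).size y = 3 * cL n ∧
      ((NegativeTriangle (6 * c + 11)).encode y).length = 9 * (cL n * cL n) + 1 := by
  have hL1 := one_le_cL n
  have hLL : cL n ≤ cL n * cL n := Nat.le_mul_self _
  have hnn : n ≤ n * n := Nat.le_mul_self _
  have hwsp : wspNT n = 2 * (n * n) + 9 * (cL n * cL n) + 3 := rfl
  have hbiL : bi * cL n < n := block_mul_lt hn hbi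
  have hbjL : bj * cL n < n := block_mul_lt hn hbj
  have hiu : cl % cL n < cL n := Nat.mod_lt _ (by omega)
  have hiv : cl / cL n < cL n := Nat.div_lt_of_lt_mul hcl
  have hM1 := one_le_cM c n
  have hpw2 : pw < 2 ^ w := by omega
  have h3LL : cL n * (3 * cL n) = 3 * (cL n * cL n) := by ring
  -- 1. the registers of the cell
  obtain ⟨st₁, hex₁, S₁, rfl, hS₁, h45₁, h46₁, h47₁, h48₁, h49₁, h50₁⟩ :=
    cellOps_spec (O := O) (H := H) (qs := qs) hR h45 hcl hcapW
  have hR₁ : Regs c n F pX S₁ := hR.of_agree fun i hi => hS₁ i (Or.inl (by omega))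
  -- 2. the back arcs
  obtain ⟨S₂, H₂, hex₂, hS₂, hT, hnT⟩ := buildT_spec (O := O) (S := S₁) (H := H) (qs := qs)
    hR₁.r2 hR₁.r9 hR₁.r19 hR₁.r22 hR₁.r24 hR₁.r25 hR₁.r27 hR₁.r30 hR₁.r38
    ((hS₁ 40 (by omega)).trans h40) ((hS₁ 42 (by omega)).trans h42) ((hS₁ 43 (by omega)).trans h43)
    h46₁ h47₁ h48₁ h49₁ h50₁ hn hL1 rfl hbiL hbjL le_rfl le_rfl hF rfl (by omega) (by omega) hpw1
    (fun t ht => by have := hlo t ht; omega)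
    (fun t ht => by have := hst.fd_le t ht; omega) hcapB hcapN (by omega)
  have hR₂ : Regs c n F pX S₂ := hR₁.of_agree fun i hi => hS₂ i (Or.inl (by omega))
  have hlowEq : ∀ a, a < F + 2 * (n * n) + 1 → H₂ a = H a := fun a ha =>
    hnT a fun r hr => by have := (tcell_bounds (F := F) (n := n) hr).1; omega
  have hhighEq : ∀ a, F + 2 * (n * n) + (9 * (cL n * cL n) + 1) ≤ a → H₂ a = H a := fun a ha =>
    hnT a fun r hr => by have := (tcell_bounds (F := F) (n := n) hr).2; omega
  have hcellEq : ∀ u v, u < 3 * cL n → v < 3 * cL n → ¬ (u / cL n = 2 ∧ v / cL n = 0) →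
      H₂ (qcell n F u v) = H (qcell n F u v) := fun u v hu hv huv =>
    hnT _ fun r hr => qcell_ne_tcell hv hr huv
  -- 3. the query
  set q₁ := qd X Y H c F pw bi bj bk with hq₁
  set qc := q₁.setWin (cl / cL n) (cl / cL n + 1) (cl % cL n) (cl % cL n + 1) with hqc
  have hcodes : ∀ u v, u < 3 * cL n → v < 3 * cL n → H₂ (qcell n F u v) = encodeInt (qc.qmatN u v) + 1 := by
    refine query_cells (c := c) qc rfl rfl (fun u v hu hv h1 h2 h3 => ?_) (fun il kl hil hkl => ?_)
      (fun kl jl hkl hjl => ?_) (fun iu iv hiu' hiv' => ?_)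
    · rw [hcellEq u v hu hv h3]; exact hst.bg u v hu hv h1 h2 h3
    · rw [hcellEq _ _ (by omega) (by omega) (by
        rintro ⟨h, -⟩; rw [Nat.div_eq_of_lt hil] at h; exact absurd h (by norm_num))]
      exact hXb il kl hil hkl
    · rw [hcellEq _ _ (by omega) (by omega) (by
        rintro ⟨h, -⟩
        rw [Nat.add_comm, Nat.add_div_right _ (by omega), Nat.div_eq_of_lt hkl] at h
        exact absurd h (by norm_num))]
      exact hYb kl jl hkl hjl
    · have hr : iu * cL n + iv < cL n * cL n := NegTriToAPSP.mul_add_lt_mul hiu' hiv'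
      have hdiv : (iu * cL n + iv) / cL n = iu := NegTriToAPSP.div_of_mul_add hiv'
      have hmod : (iu * cL n + iv) % cL n = iv := Nat.mul_add_mod_of_lt hiv'
      have := hT _ hr
      rw [tcell_eq, hdiv, hmod] at this
      rw [this, tbVal_eq_tarc (X := X) (Y := Y) (bk := bk) (Or.inr rfl) (Or.inr rfl) hiu' hiv']
      simp only [winLo, winHi, one_ne_zero, if_false, hqc, hq₁]
  have hhdr₂ : H₂ (F + 2 * (n * n)) = 3 * cL n := by rw [hlowEq _ (by omega)]; exact hst.hdr
  have hseg := readSeg_query qc rfl hhdr₂ hcodes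
  have hlo_qc : ∀ t, t < n * n → qc.lo t + qc.pw ≤ 8 * qc.M + 2 := fun t ht => by
    show H (F + t) + pw ≤ 8 * cM c n + 2; have := hlo t ht; omega
  obtain ⟨y, hency, hsize, hans⟩ := oracle_answer hO hn qc rfl rfl hXM hYM hlo_qc
  have hwit : qc.Witness ↔ q₁.PairWit (cl % cL n) (cl / cL n) := QData.witness_cell_iff _ hiv hiu
  -- 4. ask
  have hexA := ask_exec (w := w) (O := O) (S := S₂) (H := H₂) (qs := qs) hR₂ hF
  rw [hseg, hans] at hexA
  set b : ℕ := if qc.Witness then 1 else 0 with hb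
  have hb1 : b ≤ 1 := by rw [hb]; exact NegTriToAPSP.ite_le_one _
  have hbmod : [b].map (· % 2 ^ w) = [b] := by simp [Nat.mod_eq_of_lt (show b < 2 ^ w by omega)]
  rw [hbmod] at hexA
  set AB := F + 2 * (n * n) + (9 * (cL n * cL n) + 1) with hAB
  obtain ⟨hA0, hA1, hAx⟩ := segWrite_single H₂ AB b
  set H₃ := segWrite H₂ AB [b] with hH₃
  have hread : (Operand.ind 36).read (merge S₂ H₃) = b := by
    rw [Operand.read_ind_merge (by norm_num) (by rw [hR₂.r36]; omega), hR₂.r36]; exact hA1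
  -- the common part of the data after the query
  have hlow₃ : ∀ a, a < F + 2 * (n * n) + 1 → H₃ a = H a := fun a ha => by
    rw [hAx a (by omega) (by omega)]; exact hlowEq a ha
  have hhigh₃ : ∀ a, F + wspNT n ≤ a → H₃ a = H a := fun a ha => by
    rw [hAx a (by omega) (by omega)]; exact hhighEq a (by omega)
  have hcell₃ : ∀ u v, u < 3 * cL n → v < 3 * cL n → ¬ (u / cL n = 2 ∧ v / cL n = 0) →
      H₃ (qcell n F u v) = H (qcell n F u v) := fun u v hu hv huv => by
    have := qcell_bounds (F := F) (n := n) hu hv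
    rw [hAx _ (by omega) (by omega)]; exact hcellEq u v hu hv huv
  have hstatic₃ : Static c n F H₀ H₃ :=
    { below := fun a ha => by rw [hlow₃ a (by omega)]; exact hst.below a ha
      hdr := by rw [hlow₃ _ (by omega)]; exact hst.hdr
      bg := fun u v hu hv h1 h2 h3 => by rw [hcell₃ u v hu hv h3]; exact hst.bg u v hu hv h1 h2 h3
      above := fun a ha => by rw [hhigh₃ a ha]; exact hst.above a ha
      fd_le := fun t ht => by rw [hlow₃ _ (by omega)]; exact hst.fd_le t ht }
  -- 5. the test
  by_cases hp : q₁.PairWit (cl % cL n) (cl / cL n)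
  · -- a witness: mark the pair
    have hb' : b = 1 := by rw [hb, if_pos (hwit.2 hp)]
    obtain ⟨hi, hj, -⟩ := QData.PairWit.mkQ_range hp
    obtain ⟨st₅, hex₅, S₅, rfl, hS₅⟩ := markOps_spec (O := O) (H := H₃)
      (qs := qs ++ [(NegativeTriangle (6 * c + 11)).encode y]) hR₂
      ((hS₂ 40 (by omega)).trans ((hS₁ 40 (by omega)).trans h40))
      ((hS₂ 42 (by omega)).trans ((hS₁ 42 (by omega)).trans h42))
      ((hS₂ 43 (by omega)).trans ((hS₁ 43 (by omega)).trans h43))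
      ((hS₂ 47 (by omega)).trans h47₁) ((hS₂ 49 (by omega)).trans h49₁) hi hj hF hpw2 hcapW hcapN
    set idx := (bi * cL n + cl / cL n) * n + (bj * cL n + cl % cL n) with hidx
    have hidx2 : idx < n * n := NegTriToAPSP.mul_add_lt_mul hi hj
    refine ⟨S₅, Function.update H₃ (F + n * n + idx) pw, y, ?_, fun i hi' => ?_, ?_, ?_, ?_, ?_, ?_, ?_,
      hsize, by rw [hency, encodeMatrixWithTop_length]; show (3 * cL n) ^ 2 + 1 = _; ring⟩
    · have hif : Exec w O (ifz (.ind 36) skip (block markOps))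
          ⟨merge S₂ H₃, qs ++ [(NegativeTriangle (6 * c + 11)).encode y]⟩ _ (8 + 2) :=
        Exec.ifz_ne (by rw [hread, hb']; norm_num) hex₅
      have := hex₁.execLE.seqs_cons (hex₂.seqs_cons ((hency ▸ hexA).execLE.seqs_cons
        (ExecLE.seqs_one hif.execLE)))
      exact this.mono (by omega)
    · rw [hS₅ i (by omega), hS₂ i (by omega), hS₁ i (by omega)]
    · rw [hS₅ 45 (by omega), hS₂ 45 (by omega), h45₁]
    · exact
        { below := fun a ha => by
            rw [Function.update_of_ne (by omega)]; exact hstatic₃.below a ha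
          hdr := by rw [Function.update_of_ne (by omega)]; exact hstatic₃.hdr
          bg := fun u v hu hv h1 h2 h3 => by
            have := qcell_bounds (F := F) (n := n) hu hv
            rw [Function.update_of_ne (by omega)]; exact hstatic₃.bg u v hu hv h1 h2 h3
          above := fun a ha => by
            rw [Function.update_of_ne (by omega)]; exact hstatic₃.above a ha
          fd_le := fun t ht => by
            by_cases he : t = idx
            · rw [he, Function.update_self]; exact hpw4
            · rw [Function.update_of_ne (by omega)]; exact hstatic₃.fd_le t ht }
    · intro u v hu hv huv
      have := qcell_bounds (F := F) (n := n) hu hv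
      rw [Function.update_of_ne (by omega)]; exact hcell₃ u v hu hv huv
    · intro t ht
      rw [Function.update_of_ne (by omega)]; exact hlow₃ _ (by omega)
    · intro t ht
      by_cases he : t = idx
      · exact Or.inr ⟨he, hp, by rw [he, Function.update_self]⟩
      · exact Or.inl (by rw [Function.update_of_ne (by omega)]; exact hlow₃ _ (by omega))
    · intro _; exact Function.update_self _ _ _
  · -- no witness: skip
    have hb' : b = 0 := by rw [hb, if_neg (fun h => hp (hwit.1 h))]
    refine ⟨S₂, H₃, y, ?_, fun i hi' => ?_, ?_, hstatic₃, hcell₃, fun t ht => hlow₃ _ (by omega),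
      fun t ht => Or.inl (hlow₃ _ (by omega)), fun h => absurd h hp, hsize,
      by rw [hency, encodeMatrixWithTop_length]; show (3 * cL n) ^ 2 + 1 = _; ring⟩
    · have hif : Exec w O (ifz (.ind 36) skip (block markOps))
          ⟨merge S₂ H₃, qs ++ [(NegativeTriangle (6 * c + 11)).encode y]⟩
          ⟨merge S₂ H₃, qs ++ [(NegativeTriangle (6 * c + 11)).encode y]⟩ (0 + 1) :=
        Exec.ifz_zero (by rw [hread, hb']) (Exec.skip _)
      have := hex₁.execLE.seqs_cons (hex₂.seqs_cons ((hency ▸ hexA).execLE.seqs_cons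
        (ExecLE.seqs_one hif.execLE)))
      exact this.mono (by omega)
    · rw [hS₂ i (by omega), hS₁ i (by omega)]
    · rw [hS₂ 45 (by omega), h45₁]


/-- A pair witness only reads `fd` at its own pair. [folklore] -/
theorem pairWit_congr_at {n : ℕ} {X Y : Matrix (Fin n) (Fin n) (WithTop ℤ)} {M pw L bi bj bk iu iv : ℕ}
    {lo fd lo' fd' : ℕ → ℕ} (hlo : ∀ t, t < n * n → lo' t = lo t)
    (hfd : fd' ((bi * L + iv) * n + (bj * L + iu)) = fd ((bi * L + iv) * n + (bj * L + iu)))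
    (h : (mkQ X Y lo fd M pw L bi bj bk).PairWit iu iv) : (mkQ X Y lo' fd' M pw L bi bj bk).PairWit iu iv := by
  unfold QData.PairWit mkQ at h ⊢
  simp only at h ⊢
  obtain ⟨hi, hj, hf, kk, hkk, hk, x, y, hx, hy, hlt⟩ := h
  have hidx : (bi * L + iv) * n + (bj * L + iu) < n * n := NegTriToAPSP.mul_add_lt_mul hi hj
  exact ⟨hi, hj, by rw [hfd]; exact hf, kk, hkk, hk, x, y, hx, hy, by rw [hlo _ hidx]; exact hlt⟩

open Classical in
/-- **The cell sweep of a block triple** (`cells`): afterwards the triple has no pair witness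
left, every pair marked in the sweep had a witness when it was marked (so the searched value of a
marked pair lies below its threshold), nothing but found stamps and the scratch cells changed, and
if the triple had a witness at all then the number of marked pairs went up; `L²` queries of size
`3L`. [folklore] -/
theorem cells_spec {w c n F pX pw bi bj bk : ℕ} {O : List ℕ → List ℕ}
    {X Y : Matrix (Fin n) (Fin n) (WithTop ℤ)} {H₀ S H : ℕ → ℕ} {qs : List (List ℕ)}
    (hR : Regs c n F pX S) (h40 : S 40 = pw) (h42 : S 42 = bi) (h43 : S 43 = bj)
    (hn : 1 ≤ n) (hF : 100 ≤ F) (hbi : bi < cNB n) (hbj : bj < cNB n)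
    (hst : Static c n F H₀ H)
    (hXb : ∀ il kl, il < cL n → kl < cL n → H (qcell n F il (cL n + kl)) =
      encodeInt (QData.entryOr X (cM c n) (bi * cL n + il) (bk * cL n + kl)) + 1)
    (hYb : ∀ kl jl, kl < cL n → jl < cL n → H (qcell n F (cL n + kl) (2 * cL n + jl)) =
      encodeInt (QData.entryOr Y (cM c n) (bk * cL n + kl) (bj * cL n + jl)) + 1)
    (hXM : HasBoundedWeights X (cM c n)) (hYM : HasBoundedWeights Y (cM c n))
    (hpw1 : 1 ≤ pw) (hpw4 : pw ≤ 4 * cM c n)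
    (hlo : ∀ t, t < n * n → H (F + t) + pw < 8 * cM c n)
    (hsound : ∀ i j : Fin n, H (F + n * n + (i * n + j)) = pw →
      tval X Y (cM c n) (8 * cM c n) i j < H (F + (i * n + j)) + pw)
    (hO : (NegativeTriangle (6 * c + 11)).OracleAnswers O)
    (hcapB : 2 * (32 * cM c n + 9) < 2 ^ w) (hcapN : (n + cL n) * n + (n + cL n) < 2 ^ w)
    (hcapW : F + wspNT n < 2 ^ w) :
    ∃ (S' H' : ℕ → ℕ) (bs : List (NegativeTriangle (6 * c + 11)).Inst),
      ExecLE w O cells ⟨merge S H, qs⟩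
        ⟨merge S' H', qs ++ bs.map (NegativeTriangle (6 * c + 11)).encode⟩
        (1 + (cL n * cL n * (cL n * cL n * 46 + 20) + 1)) ∧
      (∀ i, i < 45 ∨ 59 < i → S' i = S i) ∧
      Static c n F H₀ H' ∧
      (∀ u v, u < 3 * cL n → v < 3 * cL n → ¬ (u / cL n = 2 ∧ v / cL n = 0) →
        H' (qcell n F u v) = H (qcell n F u v)) ∧
      (∀ t, t < n * n → H' (F + t) = H (F + t)) ∧
      (∀ t, t < n * n → H' (F + n * n + t) = H (F + n * n + t) ∨ H' (F + n * n + t) = pw) ∧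
      (∀ i j : Fin n, H' (F + n * n + (i * n + j)) = pw →
        tval X Y (cM c n) (8 * cM c n) i j < H' (F + (i * n + j)) + pw) ∧
      (∀ iu iv, iu < cL n → iv < cL n → ¬ (qd X Y H' c F pw bi bj bk).PairWit iu iv) ∧
      ((∃ iu iv, iu < cL n ∧ iv < cL n ∧ (qd X Y H c F pw bi bj bk).PairWit iu iv) →
        marks H n F pw < marks H' n F pw) ∧
      bs.length = cL n * cL n ∧
      (∀ y ∈ bs, (NegativeTriangle (6 * c + 11)).size y = 3 * cL n) ∧
      (∀ y ∈ bs, ((NegativeTriangle (6 * c + 11)).encode y).length = 9 * (cL n * cL n) + 1) := by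
  have hL1 := one_le_cL n
  have hwsp : wspNT n = 2 * (n * n) + 9 * (cL n * cL n) + 3 := rfl
  -- the initial assignment `r45 := cL n²`
  obtain ⟨st₁, hex₁, S₁, rfl, hS₁, h45₁⟩ : ∃ st₁, Exec w O (block [(.add, .dir 45, .dir 29, .imm 0)])
      ⟨merge S H, qs⟩ st₁ 1 ∧ ∃ S₁, st₁ = ⟨merge S₁ H, qs⟩ ∧ (∀ i, i ≠ 45 → S₁ i = S i) ∧ S₁ 45 = cL n * cL n := by
    refine Exec.block_of_fwd _ _ fun R hR' => ?_
    have h29 := hR.r29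
    have htmp := execOps_cons_fwd hR'; clear hR'; obtain ⟨v1, hv1, hR'⟩ := htmp
    simp -failIfUnchanged (disch := omega) only [Operand.write, Operand.read, merge_apply_of_lt,
      merge_apply_of_le, Function.update_self, Function.update_of_ne, update_merge_of_lt,
      update_merge_of_le, Nat.add_zero, BinOp.eval_add_of_lt, h29] at hv1 hR'
    simp only [execOps_nil] at hR'; subst hR'; subst hv1
    exact ⟨_, rfl, fun i hi => by simp [Function.update_of_ne, hi], by simp⟩
  -- the invariant of the sweep after `i` cells
  let Inv : ℕ → Store → Prop := fun i st => ∃ (S' H' : ℕ → ℕ) (bs : List (NegativeTriangle (6 * c + 11)).Inst),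
    st = ⟨merge S' H', qs ++ bs.map (NegativeTriangle (6 * c + 11)).encode⟩ ∧
    (∀ j, j < 45 ∨ 59 < j → S' j = S j) ∧ S' 45 = cL n * cL n - i ∧
    Static c n F H₀ H' ∧
    (∀ u v, u < 3 * cL n → v < 3 * cL n → ¬ (u / cL n = 2 ∧ v / cL n = 0) → H' (qcell n F u v) = H (qcell n F u v)) ∧
    (∀ t, t < n * n → H' (F + t) = H (F + t)) ∧
    (∀ t, t < n * n → H' (F + n * n + t) = H (F + n * n + t) ∨ H' (F + n * n + t) = pw) ∧
    (∀ i j : Fin n, H' (F + n * n + (i * n + j)) = pw →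
      tval X Y (cM c n) (8 * cM c n) i j < H' (F + (i * n + j)) + pw) ∧
    (∀ e, cL n * cL n - i ≤ e → e < cL n * cL n → ¬ (qd X Y H' c F pw bi bj bk).PairWit (e % cL n) (e / cL n)) ∧
    (∀ iu₀ iv₀, iu₀ < cL n → iv₀ < cL n → (qd X Y H c F pw bi bj bk).PairWit iu₀ iv₀ →
      H' (F + n * n + ((bi * cL n + iv₀) * n + (bj * cL n + iu₀))) = pw ∨
        (iv₀ * cL n + iu₀ < cL n * cL n - i ∧ (qd X Y H' c F pw bi bj bk).PairWit iu₀ iv₀)) ∧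
    bs.length = i ∧ (∀ y ∈ bs, (NegativeTriangle (6 * c + 11)).size y = 3 * cL n) ∧ (∀ y ∈ bs, ((NegativeTriangle (6 * c + 11)).encode y).length = 9 * (cL n * cL n) + 1)
  have h0 : Inv 0 ⟨merge S₁ H, qs⟩ := by
    refine ⟨S₁, H, [], by simp, fun j hj => hS₁ j (by omega), by rw [h45₁]; rfl, hst,
      fun _ _ _ _ _ => rfl, fun _ _ => rfl, fun _ _ => Or.inl rfl, hsound, fun e h1 h2 => by omega,
      fun iu₀ iv₀ hiu₀ hiv₀ hp => Or.inr ⟨?_, hp⟩, rfl, by simp, by simp⟩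
    exact NegTriToAPSP.mul_add_lt_mul hiv₀ hiu₀
  have hbody : ∀ i, i < cL n * cL n → ∀ st, Inv i st → (Operand.dir 45).read st.mem ≠ 0 ∧
      ∃ st', ExecLE w O (seqs [block cellOps, buildT, ask, ifz (.ind 36) skip (block markOps)]) st st'
        (cL n * cL n * 46 + 18) ∧ Inv (i + 1) st' := by
    rintro i hi st ⟨S', H', bs, rfl, hS', h45', hst', hcell', hlo', hmono', hsound', hproc', hprog', hlen', hsz', hel'⟩
    refine ⟨by show merge S' H' 45 ≠ 0; rw [merge_apply_of_lt (by norm_num), h45']; omega, ?_⟩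
    have hR' : Regs c n F pX S' := hR.of_agree fun j hj => hS' j (Or.inl (by omega))
    set cl := cL n * cL n - i - 1 with hcl
    have hclL : cl < cL n * cL n := by omega
    obtain ⟨S'', H'', y, hex, hS'', h45'', hst'', hcell'', hlo'', hfd'', hmark'', hsz'', hel''⟩ :=
      cells_iter (O := O) (qs := qs ++ bs.map (NegativeTriangle (6 * c + 11)).encode) (X := X) (Y := Y) (bk := bk) (cl := cl) hR'
        ((hS' 40 (by omega)).trans h40) ((hS' 42 (by omega)).trans h42) ((hS' 43 (by omega)).trans h43)
        (by rw [h45']; omega) hclL hn hF hbi hbj hst'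
        (fun il kl hil hkl => by
          rw [hcell' _ _ (by omega) (by omega) (by
            rintro ⟨h, -⟩; rw [Nat.div_eq_of_lt hil] at h; exact absurd h (by norm_num))]
          exact hXb il kl hil hkl)
        (fun kl jl hkl hjl => by
          rw [hcell' _ _ (by omega) (by omega) (by
            rintro ⟨h, -⟩
            rw [Nat.add_comm, Nat.add_div_right _ (by omega), Nat.div_eq_of_lt hkl] at h
            exact absurd h (by norm_num))]
          exact hYb kl jl hkl hjl)
        hXM hYM hpw1 hpw4 (fun t ht => by rw [hlo' t ht]; exact hlo t ht) hO hcapB hcapN hcapW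
    set idx := (bi * cL n + cl / cL n) * n + (bj * cL n + cl % cL n) with hidx
    refine ⟨⟨merge S'' H'', qs ++ (bs ++ [y]).map (NegativeTriangle (6 * c + 11)).encode⟩, ?_, S'', H'',
      bs ++ [y], rfl, fun j hj => (hS'' j hj).trans (hS' j hj),
      by rw [h45'']; omega, hst'', fun u v hu hv huv => (hcell'' u v hu hv huv).trans (hcell' u v hu hv huv),
      fun t ht => (hlo'' t ht).trans (hlo' t ht), fun t ht => ?_, fun i' j' hf => ?_, fun e he1 he2 hp => ?_,
      fun iu₀ iv₀ hiu₀ hiv₀ hp₀ => ?_, by simp [hlen'], fun y' hy' => ?_, fun y' hy' => ?_⟩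
    · simpa [List.map_append, List.append_assoc] using hex
    · -- fd only gains marks
      rcases hfd'' t ht with h | ⟨-, -, h⟩
      · rw [h]; exact hmono' t ht
      · exact Or.inr h
    · -- soundness of the marks
      have ht : (i' : ℕ) * n + j' < n * n := NegTriToAPSP.mul_add_lt_mul i'.isLt j'.isLt
      rw [hlo'' _ ht]
      rcases hfd'' _ ht with h | ⟨he, hpw', -⟩
      · rw [h] at hf; exact hsound' i' j' hf
      · obtain ⟨hri, hrj, -⟩ := QData.PairWit.mkQ_range hpw'
        obtain ⟨hi', hj'⟩ := idx_inj j'.isLt hrj he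
        have := tval_lt_of_pairWit (P := 8 * cM c n) hXM hYM hpw' (i := i') (j := j') hi'.symm hj'.symm (by
          have := hlo (i' * n + j') ht; rw [← hlo' _ ht] at this
          change H' (F + (i' * n + j')) + pw ≤ 8 * cM c n - 1; omega)
        exact this.2
    · -- the processed cells have no witness
      have hp' : (qd X Y H' c F pw bi bj bk).PairWit (e % cL n) (e / cL n) :=
        pairWit_anti (fun t ht => hlo'' t ht) (fun t ht => by
          rcases hfd'' t ht with h | ⟨-, -, h⟩
          · exact Or.inl h
          · exact Or.inr h) hp
      rcases Nat.lt_or_ge e (cL n * cL n - i) with hlt | hge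
      · have hecl : e = cl := by omega
        rw [hecl] at hp hp'
        have h1 := hmark'' hp'
        obtain ⟨-, -, h2⟩ := QData.PairWit.mkQ_range hp
        exact h2 h1
      · exact hproc' e hge he2 hp'
    · -- progress of a witness of the triple
      rcases hprog' iu₀ iv₀ hiu₀ hiv₀ hp₀ with h | ⟨hlt, hpw'⟩
      · left
        obtain ⟨hri, hrj, -⟩ := QData.PairWit.mkQ_range hp₀
        rcases hfd'' _ (NegTriToAPSP.mul_add_lt_mul hri hrj) with h' | ⟨-, -, h'⟩
        · rw [h']; exact h
        · exact h'
      · by_cases he : iv₀ * cL n + iu₀ = cl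
        · left
          have hdiv : cl / cL n = iv₀ := by rw [← he]; exact NegTriToAPSP.div_of_mul_add hiu₀
          have hmod : cl % cL n = iu₀ := by rw [← he]; exact Nat.mul_add_mod_of_lt hiu₀
          have := hmark'' (by rw [hdiv, hmod]; exact hpw')
          rwa [hidx, hdiv, hmod] at this
        · right
          refine ⟨by omega, ?_⟩
          obtain ⟨hri, hrj, -⟩ := QData.PairWit.mkQ_range hpw'
          refine pairWit_congr_at (fun t ht => hlo'' t ht) ?_ hpw'
          rcases hfd'' _ (NegTriToAPSP.mul_add_lt_mul hri hrj) with h' | ⟨heq, hpc, -⟩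
          · exact h'
          · exfalso
            obtain ⟨hci, hcj, -⟩ := QData.PairWit.mkQ_range hpc
            obtain ⟨h1, h2⟩ := idx_inj hrj hcj heq
            apply he
            have hiv₀' : iv₀ = cl / cL n := by omega
            have hiu₀' : iu₀ = cl % cL n := by omega
            rw [hiv₀', hiu₀']; exact Nat.div_add_mod' cl (cL n)
    · rcases List.mem_append.1 hy' with h | h
      · exact hsz' y' h
      · rw [List.mem_singleton.1 h]; exact hsz''
    · rcases List.mem_append.1 hy' with h | h
      · exact hel' y' h
      · rw [List.mem_singleton.1 h]; exact hel''
  have hexit : ∀ st, Inv (cL n * cL n) st → (Operand.dir 45).read st.mem = 0 := by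
    rintro st ⟨S', H', bs, rfl, -, h45', -⟩
    show merge S' H' 45 = 0; rw [merge_apply_of_lt (by norm_num), h45']; omega
  obtain ⟨st', hexL, S', H', bs, rfl, hS', -, hst', hcell', hlo', hmono', hsound', hproc', hprog', hlen', hsz',
    hel'⟩ := ExecLE.whilenz_invariant (w := w) (O := O) (x := .dir 45)
    (s := seqs [block cellOps, buildT, ask, ifz (.ind 36) skip (block markOps)]) (cL n * cL n) (cL n * cL n * 46 + 18)
    Inv hbody hexit h0
  refine ⟨S', H', bs, ?_, hS', hst', hcell', hlo', hmono', hsound',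
    fun iu iv hiu hiv hp => ?_, fun ⟨iu₀, iv₀, hiu₀, hiv₀, hp₀⟩ => ?_, hlen', hsz', hel'⟩
  · unfold cells
    exact hex₁.execLE.seqs_cons (ExecLE.seqs_one (by simpa using hexL))
  · have he : iv * cL n + iu < cL n * cL n := NegTriToAPSP.mul_add_lt_mul hiv hiu
    have := hproc' (iv * cL n + iu) (by omega) he
    rw [NegTriToAPSP.div_of_mul_add hiu, Nat.mul_add_mod_of_lt hiu] at this
    exact this hp
  · obtain ⟨hri, hrj, hf0⟩ := QData.PairWit.mkQ_range hp₀
    rcases hprog' iu₀ iv₀ hiu₀ hiv₀ hp₀ with h | ⟨h, -⟩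
    · exact marks_lt hmono' (NegTriToAPSP.mul_add_lt_mul hri hrj) hf0 h
    · omega

end Literature.Computability.FineGrained.NegTriSweep
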